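import Mathlib.Order.Filter.AtTopBot.Basic
import Mathlib.Topology.Order.Basic
import Mathlib.Analysis.SpecificLimits.Basic
import Mathlib.MeasureTheory.Integral.Prod
import Literature.Analysis.FluidPDE.AnomalousDissipation
import Literature.Analysis.FluidPDE.WeakSolution
import HarnessLib

/-!
# Onsager-critical anomalous dissipation for forced Navier–Stokes on `T³`
  (Bruè–Colombo–Crippa–De Lellis–Sorella 2024, §1, Theorem A — faithful statement)

Topic `Analysis/FluidPDE`, joining the story of `Literature/Analysis/FluidPDE/AnomalousDissipation.lean`
(**turb.S10–S13**; vocabulary `T3`, `R3`, `IsVanishingViscosity`, `HasAnomalousDissipation`,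
`Torus.IsClassicalNSSolutionOn`, `Torus.cumulativeDissipation`, `eLpHolderNorm`, reused, never redeclared).

E. Bruè, M. Colombo, G. Crippa, C. De Lellis, M. Sorella, *Onsager critical solutions of the forced
Navier–Stokes equations*, Commun. Pure Appl. Anal. 23 (2024) no. 10 (doi:10.3934/cpaa.2023071) =
arXiv:2212.08413 (v1, the only arXiv version; held as `paper:arxiv-2212.08413`). All locators below are
those of the arXiv v1 PDF (page-confirmed 2026-08-26): the main theorem is printed as **Theorem A**
(Anomalous dissipation), p. 2 — cited in this tree's older docstrings as "Thm. 1.1" (journal numbering,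
offprint not held) —, with equations (1.1) `v_ν(0,·) = v_in` (p. 1), (1.2)
`limsup_{ν↓0} ν ∫₀ᵀ∫_{T³} |∇v_ν|² dx dt > 0` (p. 1), (1.3) `sup_ν ‖F_ν‖_{L^{1+σ}([0,1];C^σ(T³))} < ∞`
(p. 1) and (1.4) `sup_{ν∈[0,1]} (‖v_ν‖_{L³([0,1];C^α(T³))} + ‖v_ν‖_{L^∞([0,1]×T³)}) < ∞` (p. 2).

## Why a second vendoring of this theorem

The accepted `Literature.Analysis.FluidPDE.bccds_onsager_critical` (file `AnomalousDissipation.lean`,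
**turb.S13**) records the uniform force bound only in `L¹([0,1]; L^∞(T³))` (`eLpHolderNorm 1 0`); as its
own module docstring says ("Caveat"), in that form the statement is degenerate — it is discharged in
`AnomalousDissipationProofs` (`bccds_onsager_critical_holds`) by a pulsed *Stokes* shear flow, which is
precisely the linear phenomenon the source excludes by its force class (op. cit. Remark 1.2, p. 2: with
forces bounded only in `L¹((0,1); L^∞(T³))` "anomalous dissipation would be already possible for
solutions of the forced heat equation"). The present file vendors Theorem A **as printed**: the force
class (1.3) `L^{1+σ}_t C^σ_x` for some `σ > 0`, the divergence-free mean-zero datum, the continuum family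
`{F_ν}_{ν>0}` with a *unique* smooth solution for each `ν > 0`, the uniform bound (1.4) (over
`ν ∈ [0,1]`, the Euler limit `v₀` included), anomalous dissipation (1.2), and the convergence clause
`F_ν → F₀` in `L^{1+σ}((0,1); C^σ)`, `v_ν → v₀` in `L²((0,1) × T³)` as `ν → 0` with `(v₀, p₀, F₀)`
solving forced Euler. The old `bccds_onsager_critical` is kept untouched (it is referenced elsewhere);
nothing here restates it.

## Contents

* `HasAnomalousDissipationFamily v` — **definition**: the `ε`-form of (1.2) for a *continuum* family
  `(v ν)_{ν>0}`: `∃ ε > 0`, `ε ≤ ν ∫₀¹ ‖∇v_ν‖²` for `ν > 0` arbitrarily close to `0`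
  (`∃ᶠ ν in 𝓝[>] 0`), i.e. `limsup_{ν↓0} ν ∫₀¹ ‖∇v_ν‖₂² > 0` without the junk value of `Filter.limsup`.
* `exists_isVanishingViscosity_of_frequently` — **proved**: a property holding for `ν > 0` arbitrarily
  close to `0` holds along some vanishing-viscosity sequence `ν_m ↓ 0` in `(0,1]` (the tree's
  `IsVanishingViscosity`), the bridge from the source's continuum families to the sequence vocabulary
  of `AnomalousDissipation.lean`; `HasAnomalousDissipationFamily.exists_seq` specialises it.
* `BCCDS2024_onsagerCritical` — **named fact** (Theorem A as printed, `def … : Prop`).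
* `BCCDS2024_onsagerCritical.seq` — **proved corollary**: the sequence form in the vocabulary of
  `brue_deLellis_anomalous_dissipation` / `bccds_onsager_critical` (vanishing-viscosity sequence, ONE
  datum, forces bounded in `L^{1+σ}_t C^σ_x`, classical solutions, `HasAnomalousDissipation`, uniform
  `L³_t C^α_x` and `L^∞` bounds), which is how route files on `T³ × [0,1]` consume such results.

## Design choices (faithfulness notes)

* The family is indexed by the real viscosity `ν > 0` (`F v : ℝ → (ℝ → T3 → R3)`, `p : ℝ → …`); values at
  `ν ≤ 0` are unconstrained junk. The force bound (1.3) is imposed for all `ν > 0` ("a family of forces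
  `{F_ν}_{ν>0}` … satisfying (1.3)"), the solution bound (1.4) for `ν ∈ (0,1]` and for the limit `v₀`
  (printed: `sup_{ν∈[0,1]}`, the value `ν = 0` being the Euler solution `v₀` of the convergence clause).
* Norms: `eLpHolderNorm (1+σ) σ (F ν) (Icc 0 1)` is the `L^{1+σ}([0,1]; C^{0,σ})` norm of
  `Literature.Analysis.FunctionSpaces.HolderNorm` (`‖·‖_{C^{0,σ}} = ‖·‖_∞ + [·]_σ` for the product (sup)
  metric of `T3 = Fin 3 → AddCircle 1`, equivalent to the flat metric; the junk value `0` of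
  `boundedHolderNorm` on non-Hölder slices does not arise for the smooth `F ν`, `v ν`; for the limits
  `F₀`, `v₀` the guarded `MemLpHolder` is asserted as well). `‖v_ν‖_{L^∞([0,1]×T³)}` of the smooth `v ν`
  is the pointwise `⨆_{t∈[0,1]} eSupNorm (v ν t)`; for `v₀ ∈ L^∞` the same pointwise bound is imposed on
  the representative (legitimate: the witness is existentially quantified, and a representative with
  `C^α` slices for a.e. `t`, zero slices elsewhere, realises the essential bound pointwise).
* Uniqueness ("for each `ν > 0` there is a unique solution") is recorded for the velocity among classical
  solutions on `[0,1]` with the same datum (the pressure is unique only up to a function of time);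
  cf. the tree's `Torus.IsClassicalNSSolutionOn.velocity_unique`.
* `v_ν → v₀` in `L²((0,1) × T³)` is the junk-free `∫⁻ t ∈ (0,1), ∫⁻ x, ‖v_ν − v₀‖ₑ² → 0`; "`(v₀, p₀, F₀)` is
  a solution of (E)" [with the datum (1.1)] is the accepted pressure-free weak form
  `FluidPDE.Torus.IsWeakNSSolutionForcedOn 1 0 F₀ v_in v₀` (`WeakSolution.lean`; a pressure is recovered
  by `exists_pressure_of_isWeakNSSolutionForcedOn`).
* The standing convention of the source makes the body forces divergence-free ((NS) set-up, p. 1: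
  "`F_ν : [0,T] × T³ → ℝ³` is a (divergence-free) force that may depend on `ν`"); the fact below does not
  record `div F_ν = 0` / `div F₀ = 0` (a weakening only: the printed witnesses satisfy it, and no clause
  typed here depends on it; referee finding N-LIT-2, 2026-08-26).
* NOT vendored here: Remark 1.1 (all the dissipation of the construction occurs at `T = 1`), Remark 1.2
  (the heat-equation example), and **Open Question 1** (p. 3: Theorem A for Leray solutions with a
  `ν`-independent force in `L¹((0,2); L^∞(T³))`) — an open problem, hence not Literature (it belongs,
  if needed, to a `@[conjecture]` leaf under `Summits/AnomalousDissipation/…/Theorems`). Theorems B, C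
  and Corollaries 1.4, 1.5 (§1.1, lack of selection / non-uniqueness for forced Euler) are vendored in
  the sibling file `AnomalousDissipationLackOfSelection.lean`.

## References

* E. Bruè, M. Colombo, G. Crippa, C. De Lellis, M. Sorella, Commun. Pure Appl. Anal. 23 (2024) no. 10,
  arXiv:2212.08413v1: Theorem A p. 2, (1.1)–(1.4) pp. 1–2, Remarks 1.1–1.2 p. 2, Open Question 1 p. 3.
  [`BCCDS2024`]
* E. Bruè, C. De Lellis, Comm. Math. Phys. 400 (2023) 1507–1533, arXiv:2207.06301v1: Thm. 1.1 p. 3,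
  Question 2.4 p. 5 (answered by Theorem A). [`BrueDeLellisCMP2023`]
-/

open MeasureTheory Set Filter Topology
open scoped NNReal ENNReal InnerProductSpace

noncomputable section

namespace Literature.Analysis.FluidPDE

section BCCDS

/-! ## Continuum vanishing-viscosity families: the `ε`-form of `limsup_{ν↓0} … > 0` -/

/-- **Anomalous dissipation of a continuum family** `(v ν)_{ν>0}` of velocity fields on `T³ × [0,1]`
(viscosity `ν`): `limsup_{ν↓0} ν ∫₀¹ ∫_{T³} |∇v_ν|² dx dt > 0` (Bruè–Colombo–Crippa–De Lellis–Sorella,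
arXiv:2212.08413v1, (1.2) p. 1 with `T = 1`), stated in the junk-free `ε`-form: there is `ε > 0` such that
`ε ≤ ν ∫₀¹ ‖∇v_ν(t)‖₂² dt = Torus.cumulativeDissipation ν (v ν) 0 1` for `ν > 0` arbitrarily close to `0`
(`∃ᶠ ν in 𝓝[>] 0`). The sequence analogue is `HasAnomalousDissipation`. [cite: BCCDS2024, (1.2) p. 1] -/
def HasAnomalousDissipationFamily (v : ℝ → ℝ → T3 → R3) : Prop :=
  ∃ ε : ℝ, 0 < ε ∧
    ∃ᶠ ν in 𝓝[>] (0 : ℝ), ε ≤ FunctionSpaces.Torus.cumulativeDissipation ν (v ν) 0 1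

/-- Auxiliary recursion for `exists_isVanishingViscosity_of_frequently`: `ν₀ = g 1`,
`ν_{m+1} = g (min ν_m (1/(m+2)))`, where `g δ ∈ (0, δ)` is a good viscosity below `δ`. [folklore] -/
private def seqBelow (g : ℝ → ℝ) : ℕ → ℝ
  | 0 => g 1
  | m + 1 => g (min (seqBelow g m) (1 / ((m : ℝ) + 2)))

/-- **Sequence extraction.** If a property `P ν` holds for positive `ν` arbitrarily close to `0`
(`∃ᶠ ν in 𝓝[>] 0, P ν`), then it holds along a vanishing-viscosity sequence: there is `ν : ℕ → ℝ`,
strictly decreasing, positive, `ν m → 0` (`IsVanishingViscosity ν`), with `ν m ≤ 1` and `P (ν m)` for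
every `m`. (Choose `ν_{m+1} ∈ (0, min(ν_m, 1/(m+2)))` with `P ν_{m+1}`.) This is the passage from
"`limsup_{ν↓0} … > 0`" for a continuum family (BCCDS, arXiv:2212.08413v1, (1.2) p. 1) to a sequence
`ν_m ↓ 0` realising it (the formulation of Bruè–De Lellis, arXiv:2207.06301v1, (1.5) p. 3, and of
`HasAnomalousDissipation`). [cite: BCCDS2024, (1.2) p. 1 — sequence realising the limsup] -/
theorem exists_isVanishingViscosity_of_frequently {P : ℝ → Prop}
    (h : ∃ᶠ ν in 𝓝[>] (0 : ℝ), P ν) :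
    ∃ ν : ℕ → ℝ, IsVanishingViscosity ν ∧ (∀ m, ν m ≤ 1) ∧ ∀ m, P (ν m) := by
  have key : ∀ δ : ℝ, 0 < δ → ∃ ν, P ν ∧ ν ∈ Ioo 0 δ := fun δ hδ =>
    (h.and_eventually (Ioo_mem_nhdsGT hδ)).exists
  choose! g hg using key
  -- `hg δ hδ : P (g δ) ∧ g δ ∈ Ioo 0 δ`
  have h0 : seqBelow g 0 = g 1 := rfl
  have hs : ∀ m, seqBelow g (m + 1) = g (min (seqBelow g m) (1 / ((m : ℝ) + 2))) := fun m => rfl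
  -- positivity, the property, and the bound `ν m ≤ 1/(m+1)`, by induction
  have main : ∀ m, 0 < seqBelow g m ∧ P (seqBelow g m) ∧ seqBelow g m ≤ 1 / ((m : ℝ) + 1) := by
    intro m
    induction m with
    | zero =>
      obtain ⟨hP, hlo, hhi⟩ := hg 1 one_pos
      refine ⟨by simpa [h0] using hlo, by simpa [h0] using hP, ?_⟩
      simpa [h0] using hhi.le
    | succ m ih =>
      obtain ⟨hpos, -, -⟩ := ih
      have hδ : 0 < min (seqBelow g m) (1 / ((m : ℝ) + 2)) := lt_min hpos (by positivity)
      obtain ⟨hP, hlo, hhi⟩ := hg _ hδ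
      refine ⟨by simpa [hs] using hlo, by simpa [hs] using hP, ?_⟩
      rw [hs]
      have h2 : ((m + 1 : ℕ) : ℝ) + 1 = (m : ℝ) + 2 := by push_cast; ring
      rw [h2]
      exact hhi.le.trans (min_le_right _ _)
  have hlt : ∀ m, seqBelow g (m + 1) < seqBelow g m := by
    intro m
    have hδ : 0 < min (seqBelow g m) (1 / ((m : ℝ) + 2)) := lt_min (main m).1 (by positivity)
    obtain ⟨-, -, hhi⟩ := hg _ hδ
    rw [hs]
    exact hhi.trans_le (min_le_left _ _)
  refine ⟨seqBelow g, ⟨strictAnti_nat_of_succ_lt hlt, ?_, fun m => (main m).1⟩, fun m => ?_,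
    fun m => (main m).2.1⟩
  · exact tendsto_of_tendsto_of_tendsto_of_le_of_le tendsto_const_nhds
      tendsto_one_div_add_atTop_nhds_zero_nat (fun m => (main m).1.le) (fun m => (main m).2.2)
  · refine ((main m).2.2).trans ?_
    rw [div_le_one (by positivity)]
    linarith [(Nat.cast_nonneg m : (0 : ℝ) ≤ m)]

/-- A continuum family with anomalous dissipation has a vanishing-viscosity subsequence `ν_m ↓ 0` in
`(0,1]` along which `ν_m ∫₀¹ ‖∇v_{ν_m}‖₂² ≥ ε` for every `m`; in particular the sequence
`m ↦ v (ν m)` has anomalous dissipation in the sense of `HasAnomalousDissipation` — the passage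
from the `limsup_{ν↓0}` form (1.2) of BCCDS to the sequence form (1.5) of Bruè–De Lellis 2023.
[cite: BCCDS2024, (1.2) p. 1 — sequence form] -/
theorem HasAnomalousDissipationFamily.exists_seq {v : ℝ → ℝ → T3 → R3}
    (h : HasAnomalousDissipationFamily v) :
    ∃ ν : ℕ → ℝ, IsVanishingViscosity ν ∧ (∀ m, ν m ≤ 1) ∧
      HasAnomalousDissipation ν (fun m => v (ν m)) := by
  obtain ⟨ε, hε, hfreq⟩ := h
  obtain ⟨ν, hν, hle, hP⟩ := exists_isVanishingViscosity_of_frequently hfreq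
  exact ⟨ν, hν, hle, ε, hε, Eventually.of_forall hP⟩

/-! ## Theorem A as printed -/

/-- **Bruè–Colombo–Crippa–De Lellis–Sorella, Theorem A (Anomalous dissipation)** (arXiv:2212.08413v1
p. 2; = the main theorem "Thm. 1.1" of Commun. Pure Appl. Anal. 23 (2024) in the numbering used by
`bccds_onsager_critical`), verbatim: "Let `T = 1`. For any `α < 1/3` there exist `σ > 0`, a
divergence-free initial datum `v_in ∈ C^∞(T³; ℝ³)` with `∫_{T³} v_in = 0`, and a family of forces
`{F_ν}_{ν>0} ⊂ C^∞([0,1] × T³; ℝ³)` satisfying (1.3) [`sup_ν ‖F_ν‖_{L^{1+σ}([0,1]; C^σ(T³))} < ∞`] such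
that: • for each `ν > 0` there is a unique solution to (NS) with `v_ν(0,·) = v_in(·)` which satisfies
`sup_{ν∈[0,1]} (‖v_ν‖_{L³([0,1]; C^α(T³))} + ‖v_ν‖_{L^∞([0,1] × T³)}) < ∞` (1.4); • (1.2) holds
[`limsup_{ν↓0} ν ∫₀¹∫_{T³} |∇v_ν|² dx dt > 0`]. Furthermore, we have that `F_ν → F₀` in
`L^{1+σ}((0,1); C^σ(T³))` and `v_ν → v₀` in `L²((0,1) × T³)` as `ν → 0`, and in particular
`(v₀, p₀, F₀)` is a solution of (E) [forced Euler, with the datum (1.1)]."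
Rendering (see the module docstring for the conventions): `α σ : ℝ≥0`; the family is indexed by the real
`ν > 0`; (NS) on `[0,1]` is `Torus.IsClassicalNSSolutionOn (Icc 0 1) ν (F ν) (v ν) (p ν)` with
`v ν 0 = v_in`, uniqueness is that of the velocity among classical solutions with the same datum; (1.4)
is imposed for `ν ∈ (0,1]` and for `v₀`; (1.2) is `HasAnomalousDissipationFamily v`; the Euler limit is
the pressure-free weak forced solution with datum `v_in` on `(0,1)`. This answers Bruè–De Lellis,
CMP 400 (2023), Question 2.4. [cite: BCCDS2024, Thm. A p. 2 (arXiv:2212.08413v1); (1.1)–(1.4)] -/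
def BCCDS2024_onsagerCritical : Prop :=
  ∀ (α : ℝ≥0), α < 1 / 3 →
    ∃ (σ : ℝ≥0) (v_in : T3 → R3) (F v : ℝ → ℝ → T3 → R3) (p : ℝ → ℝ → T3 → ℝ)
      (F₀ v₀ : ℝ → T3 → R3),
      0 < σ ∧
      -- the datum: smooth, divergence free, mean zero
      FunctionSpaces.Torus.IsSmooth v_in ∧ FunctionSpaces.Torus.IsDivFree v_in ∧
        FunctionSpaces.Torus.HasZeroMean v_in ∧
      -- the forces: smooth on `[0,1] × T³`, uniformly bounded in `L^{1+σ}([0,1]; C^σ)`  (1.3)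
      (∀ ν : ℝ, 0 < ν → FunctionSpaces.Torus.IsSmoothSpaceTimeOn (Icc 0 1) (F ν)) ∧
      (∃ C : ℝ≥0∞, C < ∞ ∧
        ∀ ν : ℝ, 0 < ν → FunctionSpaces.eLpHolderNorm (1 + (σ : ℝ≥0∞)) σ (F ν) (Icc 0 1) ≤ C) ∧
      -- for each `ν > 0`: the (unique) classical solution from `v_in`
      (∀ ν : ℝ, 0 < ν →
        FunctionSpaces.Torus.IsClassicalNSSolutionOn (Icc 0 1) ν (F ν) (v ν) (p ν) ∧ v ν 0 = v_in ∧
        ∀ (w : ℝ → T3 → R3) (q : ℝ → T3 → ℝ),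
          FunctionSpaces.Torus.IsClassicalNSSolutionOn (Icc 0 1) ν (F ν) w q → w 0 = v_in →
            ∀ t ∈ Icc (0 : ℝ) 1, w t = v ν t) ∧
      -- the uniform Onsager-critical and `L^∞` bound (1.4), `ν ∈ (0,1]` and the limit `v₀`
      (∃ C : ℝ≥0∞, C < ∞ ∧
        (∀ ν : ℝ, 0 < ν → ν ≤ 1 →
          FunctionSpaces.eLpHolderNorm 3 α (v ν) (Icc 0 1) +
            (⨆ t ∈ Icc (0 : ℝ) 1, FunctionSpaces.eSupNorm (v ν t)) ≤ C) ∧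
        FunctionSpaces.MemLpHolder 3 α v₀ (Icc 0 1) ∧
        FunctionSpaces.eLpHolderNorm 3 α v₀ (Icc 0 1) +
            (⨆ t ∈ Icc (0 : ℝ) 1, FunctionSpaces.eSupNorm (v₀ t)) ≤ C) ∧
      -- anomalous dissipation (1.2)
      HasAnomalousDissipationFamily v ∧
      -- `F_ν → F₀` in `L^{1+σ}((0,1); C^σ)` as `ν → 0`
      FunctionSpaces.MemLpHolder (1 + (σ : ℝ≥0∞)) σ F₀ (Icc 0 1) ∧
      Tendsto (fun ν => FunctionSpaces.eLpHolderNorm (1 + (σ : ℝ≥0∞)) σ (fun t => F ν t - F₀ t) (Icc 0 1))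
        (𝓝[>] 0) (𝓝 0) ∧
      -- `v_ν → v₀` in `L²((0,1) × T³)` as `ν → 0`
      Tendsto (fun ν => ∫⁻ t in Ioo (0 : ℝ) 1, ∫⁻ x, ‖v ν t x - v₀ t x‖ₑ ^ 2) (𝓝[>] 0) (𝓝 0) ∧
      -- `(v₀, p₀, F₀)` solves forced Euler with datum `v_in` (weak form on `(0,1)`)
      FluidPDE.Torus.IsWeakNSSolutionForcedOn 1 0 F₀ v_in v₀

/-- **Sequence form of Theorem A** (proved from `BCCDS2024_onsagerCritical`), in the vocabulary of
`brue_deLellis_anomalous_dissipation` / `bccds_onsager_critical`: for every `α < 1/3` there are `σ > 0`,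
viscosities `ν_m ↓ 0` in `(0,1]` (`IsVanishingViscosity`), one smooth divergence-free mean-zero datum
`v_in`, smooth forces `f_m` on `[0,1] × T³` uniformly bounded in `L^{1+σ}([0,1]; C^σ(T³))`, classical
solutions `(u_m, p_m)` of Navier–Stokes with viscosity `ν_m`, force `f_m`, `u_m(0) = v_in`, with
anomalous dissipation `liminf_m ν_m ∫₀¹ ‖∇u_m‖₂² > 0` (`HasAnomalousDissipation`) and the uniform bound
`sup_m (‖u_m‖_{L³([0,1]; C^α)} + ‖u_m‖_{L^∞([0,1] × T³)}) < ∞`. (Extract `ν_m ↓ 0` realising the `limsup`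
of (1.2) by `exists_isVanishingViscosity_of_frequently` and restrict the family to it.)
[cite: BCCDS2024, Thm. A p. 2 (arXiv:2212.08413v1), sequence form] -/
theorem BCCDS2024_onsagerCritical.seq (h : BCCDS2024_onsagerCritical) :
    ∀ (α : ℝ≥0), α < 1 / 3 →
      ∃ (σ : ℝ≥0) (ν : ℕ → ℝ) (v_in : T3 → R3) (f u : ℕ → ℝ → T3 → R3) (p : ℕ → ℝ → T3 → ℝ),
        0 < σ ∧ IsVanishingViscosity ν ∧
        FunctionSpaces.Torus.IsSmooth v_in ∧ FunctionSpaces.Torus.IsDivFree v_in ∧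
          FunctionSpaces.Torus.HasZeroMean v_in ∧
        (∀ m, FunctionSpaces.Torus.IsSmoothSpaceTimeOn (Icc 0 1) (f m)) ∧
        (∃ C : ℝ≥0∞, C < ∞ ∧
          ∀ m, FunctionSpaces.eLpHolderNorm (1 + (σ : ℝ≥0∞)) σ (f m) (Icc 0 1) ≤ C) ∧
        (∀ m, FunctionSpaces.Torus.IsClassicalNSSolutionOn (Icc 0 1) (ν m) (f m) (u m) (p m) ∧
          u m 0 = v_in) ∧
        HasAnomalousDissipation ν u ∧
        ∃ C : ℝ≥0∞, C < ∞ ∧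
          ∀ m, FunctionSpaces.eLpHolderNorm 3 α (u m) (Icc 0 1) +
            (⨆ t ∈ Icc (0 : ℝ) 1, FunctionSpaces.eSupNorm (u m t)) ≤ C := by
  intro α hα
  obtain ⟨σ, v_in, F, v, p, F₀, v₀, hσ, hsm, hdiv, hmean, hFsm, ⟨CF, hCF, hFbd⟩, hsol,
    ⟨Cv, hCv, hvbd, -, -⟩, hdiss, -, -, -, -⟩ := h α hα
  obtain ⟨ε, hε, hfreq⟩ := hdiss
  obtain ⟨ν, hν, hle1, hP⟩ := exists_isVanishingViscosity_of_frequently hfreq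
  have hpos : ∀ m, 0 < ν m := hν.2.2
  refine ⟨σ, ν, v_in, fun m => F (ν m), fun m => v (ν m), fun m => p (ν m), hσ, hν, hsm, hdiv, hmean,
    fun m => hFsm _ (hpos m), ⟨CF, hCF, fun m => hFbd _ (hpos m)⟩,
    fun m => ⟨(hsol _ (hpos m)).1, (hsol _ (hpos m)).2.1⟩, ⟨ε, hε, Eventually.of_forall hP⟩,
    Cv, hCv, fun m => hvbd _ (hpos m) (hle1 m)⟩

end BCCDS

end Literature.Analysis.FluidPDE

end
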